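import Summits.CriticalPhenomena.PercolationContinuityZ3.Theorems.PercNearOneGluingAdditiveGluingKnThm2Refined
import HarnessLib

/-! # Crux `PercNearOneGluing.NoHeavyLowerTail` (stmt-CriticalPhenomena-4575) / `AdditiveGluing` (4576), three relays —
# the BRIDGED refined Kozma–Nitzan exchange, auxiliary file: connection in `H = G − o`, the bridge lemma, BHK 2006 Thm 1.3
# with the increasing function `1{O ↔ b in H}` of the cluster of `O ∪ {o}`, the plus-term split, the arithmetic core
# (depth prover `nh-dp-commonrelay`, gen 4)

Support file (`--supports stmt-CriticalPhenomena-4575`); no definitions, no named facts, no sorries.  The assembly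
(`knThm2_bridged`, `knThm2_bridged'`, `knThm2_bridged_eform`) is the sibling file `…KnThm2Bridged.lean`.

Setting of Kozma–Nitzan's Theorem 2 (arXiv:2401.12397, pp. 8–9): relays `a₁, a₂, a₃` (designated `a₃`), observer `o`, target
`b`, `X := μ(o↔A, o↔b) − μ(o↔A, a₃↔b) = I + II + III` (`stub_knThm2GoodSplit`), refined conditioning events
`N'₁₂ = {a₁,a₂,o ↮ a₃}`, `N'₁ = {a₁,o ↮ a₂,a₃}`, `N'₂` (seat (d)'s `knThm2_refined`: source sets `O ∪ {o}`).  Write `H = G − o`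
(all pairs at `o` closed: the configuration `ω ∖ {e | o ∈ e}`), `T_O = ⋂_{s∈O} {s ↔ b}` and `H_O = ⋂_{s∈O} {s ↔ b in H} ⊆ T_O`.
On `T_O ∖ H_O` some `s ∈ O` reaches `b` only through `o`, so `o ↔ O` holds AUTOMATICALLY (`knBr_bridge`); hence the plus-term
`μ(N'_O ∩ {o↔O} ∩ T_O)` equals `μ(N'_O ∩ {o↔O} ∩ H_O) + μ(N'_O ∩ (T_O ∖ H_O))`, and BHK 2006 Thm 1.3 (cluster of the SET `O ∪ {o}`,
with the increasing function `1{O ↔ b in H}` of that cluster, `knBr_bhkOne`) is applied to the first part only: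
  `P'_O · μ(N'_O ∩ {o↔O} ∩ T_O) ≥ A_O · h_O + P'_O · (m'_O − h_O)`,  `h_O := μ(N'_O ∩ H_O) ≤ m'_O := μ(N'_O ∩ T_O)`,
while the minus terms are bounded exactly as in `knThm2_refined` (`knRef_bhkTwo`).  Result (`knThm2_bridged`): the pre-FKG
inequality (3) at `a₃` follows from the BRIDGED CERTIFICATE
  `Σ_O  w_O · [A_O (h_O − m'_{A∖O}) + P'_O (m'_O − h_O)] ≥ 0`   (`w₁₂ = P'₁P'₂`, `w₁ = P'₂P'₁₂`, `w₂ = P'₁P'₁₂`),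
i.e. in conditional form `X ≥ Θ'' := Σ_O [φ'_O (h_O − m'_{A∖O}) + (m'_O − h_O)] = Θ' + Σ_O (1 − φ'_O)(m'_O − h_O) ≥ Θ'`.
Why it matters (this seat's exact engine + kit census, memo RESIDUAL-gen4.md in run/shared/lean/prim/prim-nh-dp-commonrelay/):
with `a₃` the `τ`-minimiser, `Θ'' ≥ 0` held on every instance examined (random, full-tie, gen-3 corners, adversarial climbs),
including the joint failures of the refined chain `Θ'` and of the one-step BHK(O,b) certificate, and `Θ'' = X` EXACTLY when
`o` is adjacent only to relays (KN Theorem 4's stratum) — the first three-relay certificate with no known failure.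
Corollaries: unconditional form (`knThm2_bridged'`, via the landed `stub_bhkSets`) and the additive E-form.
[cite: KozmaNitzan2024, Theorem 2 (§3.1, pp. 8–9), Theorem 4 / Lemma 5 (§3.2, pp. 12–14); VandenbergHaggstromKahn2005, Thms. 1.3–1.4]
-/

namespace Summit.CriticalPhenomena.PercolationContinuityZ3.Theorems

open MeasureTheory Set Literature.Probability.LatticeModels Literature.Probability.Percolation

noncomputable section
open Classical

section General

variable {V : Type*}

/-- Connection in `H = G − o` (all pairs at `o` removed) implies connection in `G`. [folklore] -/
theorem knBr_reach_of_reachOff {ω : BondConfig V} {o s b : V}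
    (h : (openGraph (ω \ {e | o ∈ e})).Reachable s b) : (openGraph ω).Reachable s b :=
  h.mono (openGraph_mono Set.sdiff_subset)

/-- **Bridge lemma.** If `s ↔ b` in `ω` but not in `ω` with the pairs at `o` removed, then every open path from `s` to `b`
passes through `o`; in particular `s ↔ o`. [folklore] -/
theorem knBr_bridge {ω : BondConfig V} {o s b : V} (h : (openGraph ω).Reachable s b)
    (hH : ¬ (openGraph (ω \ {e | o ∈ e})).Reachable s b) : (openGraph ω).Reachable s o := by
  obtain ⟨p⟩ := h
  by_cases ho : o ∈ p.support
  · exact ⟨p.takeUntil o ho⟩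
  · exfalso
    apply hH
    have hp : ∀ e, e ∈ p.edges → e ∈ (openGraph (ω \ {e | o ∈ e})).edgeSet := by
      intro e he
      have he' : e ∈ (openGraph ω).edgeSet := p.edges_subset_edgeSet he
      simp only [openGraph, SimpleGraph.edgeSet_fromEdgeSet, Set.mem_sdiff, Set.mem_setOf_eq] at he' ⊢
      refine ⟨⟨he'.1, fun hoe => ho ?_⟩, he'.2⟩
      exact SimpleGraph.Walk.mem_support_iff_exists_mem_edges.2 (Or.inr ⟨e, he, hoe⟩)
    exact ⟨p.transfer _ hp⟩

/-- An open path from `s` avoiding the pairs at `o` runs inside `C_s(ω) ∖ {e | o ∈ e}`. [folklore] -/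
theorem knBr_reachOff_openEdgeCluster {ω : BondConfig V} {o s b : V}
    (h : (openGraph (ω \ {e | o ∈ e})).Reachable s b) :
    (openGraph (openEdgeCluster ω s \ {e | o ∈ e})).Reachable s b := by
  have h1 := knThm2_reachable_openEdgeCluster h
  refine h1.mono (openGraph_mono ?_)
  intro e he
  rcases (mem_openEdgeCluster_iff _ s e).1 he with ⟨heω, hdiag, hreach⟩
  refine ⟨(mem_openEdgeCluster_iff ω s e).2 ⟨heω.1, hdiag, fun v hv => knBr_reach_of_reachOff (hreach v hv)⟩, heω.2⟩

/-- For `s ∈ S`, connection from `s` to `b` avoiding `o` inside the cluster `C_S(ω) = ⋃_{s' ∈ S} C_{s'}(ω)` of the set `S`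
is connection avoiding `o` in `ω`. [folklore] -/
theorem knBr_reachOff_biUnion_iff (S : Finset V) {s : V} (hs : s ∈ S) (o b : V) (ω : BondConfig V) :
    (openGraph ((⋃ s' ∈ S, openEdgeCluster ω s') \ {e | o ∈ e})).Reachable s b ↔
      (openGraph (ω \ {e | o ∈ e})).Reachable s b := by
  constructor
  · intro h
    exact h.mono (openGraph_mono (Set.sdiff_subset_sdiff_left
      (Set.iUnion₂_subset fun s' _ => openEdgeCluster_subset ω s')))
  · intro h
    refine (knBr_reachOff_openEdgeCluster h).mono (openGraph_mono (Set.sdiff_subset_sdiff_left ?_))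
    exact Set.subset_iUnion₂ (s := fun s' (_ : s' ∈ S) => openEdgeCluster ω s') s hs

/-- The indicator of the up-set `{C | ∀ s ∈ O, s ↔ b in C ∖ {e | o ∈ e}}` of sets of edges is increasing. [folklore] -/
theorem knBr_monotone_allReachOff (O : Finset V) (o b : V) :
    Monotone ({C : Set (Sym2 V) | ∀ s ∈ O, (openGraph (C \ {e | o ∈ e})).Reachable s b}.indicator
      (1 : Set (Sym2 V) → ℝ)) := by
  intro C C' hCC'
  by_cases h : C ∈ {C : Set (Sym2 V) | ∀ s ∈ O, (openGraph (C \ {e | o ∈ e})).Reachable s b}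
  · have h' : C' ∈ {C : Set (Sym2 V) | ∀ s ∈ O, (openGraph (C \ {e | o ∈ e})).Reachable s b} :=
      fun s hs => (h s hs).mono (openGraph_mono (Set.sdiff_subset_sdiff_left hCC'))
    rw [Set.indicator_of_mem h, Set.indicator_of_mem h', Pi.one_apply, Pi.one_apply]
  · rw [Set.indicator_of_notMem h]
    exact Set.indicator_nonneg (fun _ _ => zero_le_one) _

/-- At `C = C_S(ω)` and for `O ⊆ S`: the indicator of `{C | ∀ s ∈ O, s ↔ b in C ∖ {e | o ∈ e}}` is
`1{∀ s ∈ O, s ↔ b in H}(ω)`. [folklore] -/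
theorem knBr_allReachOff_apply_sub (S O : Finset V) (hOS : O ⊆ S) (o b : V) (ω : BondConfig V) :
    {C : Set (Sym2 V) | ∀ s ∈ O, (openGraph (C \ {e | o ∈ e})).Reachable s b}.indicator (1 : Set (Sym2 V) → ℝ)
        (⋃ s' ∈ S, openEdgeCluster ω s') =
      (⋂ s ∈ O, {ω' : BondConfig V | (openGraph (ω' \ {e | o ∈ e})).Reachable s b}).indicator 1 ω := by
  by_cases h : ∀ s ∈ O, (openGraph (ω \ {e | o ∈ e})).Reachable s b
  · have h1 : (⋃ s' ∈ S, openEdgeCluster ω s') ∈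
        {C : Set (Sym2 V) | ∀ s ∈ O, (openGraph (C \ {e | o ∈ e})).Reachable s b} :=
      fun s hs => (knBr_reachOff_biUnion_iff S (hOS hs) o b ω).2 (h s hs)
    have h2 : ω ∈ ⋂ s ∈ O, {ω' : BondConfig V | (openGraph (ω' \ {e | o ∈ e})).Reachable s b} := by
      simp only [Set.mem_iInter, Set.mem_setOf_eq]
      exact h
    rw [Set.indicator_of_mem h1, Set.indicator_of_mem h2, Pi.one_apply, Pi.one_apply]
  · have h1 : (⋃ s' ∈ S, openEdgeCluster ω s') ∉
        {C : Set (Sym2 V) | ∀ s ∈ O, (openGraph (C \ {e | o ∈ e})).Reachable s b} :=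
      fun h' => h fun s hs => (knBr_reachOff_biUnion_iff S (hOS hs) o b ω).1 (h' s hs)
    have h2 : ω ∉ ⋂ s ∈ O, {ω' : BondConfig V | (openGraph (ω' \ {e | o ∈ e})).Reachable s b} := by
      simp only [Set.mem_iInter, Set.mem_setOf_eq]
      exact h
    rw [Set.indicator_of_notMem h1, Set.indicator_of_notMem h2]

end General

variable {n : ℕ}

/-- **BHK 2006 Thm. 1.3 for the cluster of the set `S`, with the increasing functions `1{O ↔ o}` and `1{O ↔ b in H}`**
(`O ⊆ S`, hypothesis `hB1` = first half of `stub_bhkSets`): with `D = {S ↮ X}` and `H_O = ⋂_{s∈O} {s ↔ b in H}`,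
`μ(D ∩ {O ↔ o}) μ(D ∩ H_O) ≤ μ(D) μ(D ∩ {O ↔ o} ∩ H_O)`. [cite: VandenbergHaggstromKahn2005, Thm. 1.3 (p. 6)] -/
theorem knBr_bhkOne
    (hB1 : ∀ (n : ℕ) (w : Sym2 (Fin n) → unitInterval) (S : Finset (Fin n)) (X : Set (Fin n))
        (F G : Set (Sym2 (Fin n)) → ℝ), Monotone F → Monotone G → (∀ s ∈ S, s ∉ X) →
        (∫ ω in {ω : BondConfig (Fin n) | ∀ s ∈ S, ∀ x ∈ X, ¬ (openGraph ω).Reachable s x},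
            F (⋃ s ∈ S, openEdgeCluster ω s) ∂(prodBernoulli w)) *
          (∫ ω in {ω : BondConfig (Fin n) | ∀ s ∈ S, ∀ x ∈ X, ¬ (openGraph ω).Reachable s x},
            G (⋃ s ∈ S, openEdgeCluster ω s) ∂(prodBernoulli w)) ≤
        (prodBernoulli w).real
            {ω : BondConfig (Fin n) | ∀ s ∈ S, ∀ x ∈ X, ¬ (openGraph ω).Reachable s x} *
          ∫ ω in {ω : BondConfig (Fin n) | ∀ s ∈ S, ∀ x ∈ X, ¬ (openGraph ω).Reachable s x},
            F (⋃ s ∈ S, openEdgeCluster ω s) * G (⋃ s ∈ S, openEdgeCluster ω s)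
              ∂(prodBernoulli w))
    (w : Sym2 (Fin n) → unitInterval) (S O : Finset (Fin n)) (hOS : O ⊆ S) (X : Set (Fin n)) (o b : Fin n)
    (hSX : ∀ s ∈ S, s ∉ X) :
    (prodBernoulli w).real
          ({ω : BondConfig (Fin n) | ∀ s ∈ S, ∀ x ∈ X, ¬ (openGraph ω).Reachable s x} ∩
            ⋃ s ∈ O, openConn s o) *
        (prodBernoulli w).real
          ({ω : BondConfig (Fin n) | ∀ s ∈ S, ∀ x ∈ X, ¬ (openGraph ω).Reachable s x} ∩
            ⋂ s ∈ O, {ω' : BondConfig (Fin n) | (openGraph (ω' \ {e | o ∈ e})).Reachable s b}) ≤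
      (prodBernoulli w).real
          {ω : BondConfig (Fin n) | ∀ s ∈ S, ∀ x ∈ X, ¬ (openGraph ω).Reachable s x} *
        (prodBernoulli w).real
          ({ω : BondConfig (Fin n) | ∀ s ∈ S, ∀ x ∈ X, ¬ (openGraph ω).Reachable s x} ∩
            ((⋃ s ∈ O, openConn s o) ∩
              ⋂ s ∈ O, {ω' : BondConfig (Fin n) | (openGraph (ω' \ {e | o ∈ e})).Reachable s b})) := by
  have key := hB1 n w S X
    ({C : Set (Sym2 (Fin n)) | ∃ s ∈ O, (openGraph C).Reachable s o}.indicator 1)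
    ({C : Set (Sym2 (Fin n)) | ∀ s ∈ O, (openGraph (C \ {e | o ∈ e})).Reachable s b}.indicator 1)
    (knThm2_monotone_anyReach O o) (knBr_monotone_allReachOff O o b) hSX
  simp only [knRef_anyReach_apply_sub S O hOS, knBr_allReachOff_apply_sub S O hOS] at key
  have h := knThm2_setIntegral_indicator w
    {ω : BondConfig (Fin n) | ∀ s ∈ S, ∀ x ∈ X, ¬ (openGraph ω).Reachable s x}
    (⋃ s ∈ O, openConn s o) (⋂ s ∈ O, {ω' : BondConfig (Fin n) | (openGraph (ω' \ {e | o ∈ e})).Reachable s b})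
  have h' := knThm2_setIntegral_indicator w
    {ω : BondConfig (Fin n) | ∀ s ∈ S, ∀ x ∈ X, ¬ (openGraph ω).Reachable s x}
    (⋂ s ∈ O, {ω' : BondConfig (Fin n) | (openGraph (ω' \ {e | o ∈ e})).Reachable s b})
    (⋂ s ∈ O, {ω' : BondConfig (Fin n) | (openGraph (ω' \ {e | o ∈ e})).Reachable s b})
  rw [h.1, h'.1, h.2] at key
  exact key

/-- **Splitting a plus-term along the bridge.**  For any event `N` and source set `O`:
`μ(N ∩ ({O ↔ o} ∩ T_O)) = μ(N ∩ ({O ↔ o} ∩ H_O)) + (μ(N ∩ T_O) − μ(N ∩ H_O))`, because `H_O ⊆ T_O` and on `T_O ∖ H_O`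
the observer is joined to `O` (`knBr_bridge`). [folklore] -/
theorem knBr_plus_split (w : Sym2 (Fin n) → unitInterval) (N : Set (BondConfig (Fin n))) (O : Finset (Fin n)) (o b : Fin n) :
    (prodBernoulli w).real (N ∩ ((⋃ s ∈ O, openConn s o) ∩ ⋂ s ∈ O, openConn s b)) =
      (prodBernoulli w).real (N ∩ ((⋃ s ∈ O, openConn s o) ∩
          ⋂ s ∈ O, {ω' : BondConfig (Fin n) | (openGraph (ω' \ {e | o ∈ e})).Reachable s b})) +
        ((prodBernoulli w).real (N ∩ ⋂ s ∈ O, openConn s b) -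
          (prodBernoulli w).real (N ∩ ⋂ s ∈ O, {ω' : BondConfig (Fin n) | (openGraph (ω' \ {e | o ∈ e})).Reachable s b})) := by
  have hm : ∀ s : Set (BondConfig (Fin n)), MeasurableSet s := fun _ => MeasurableSet.of_discrete
  -- abbreviations
  set U : Set (BondConfig (Fin n)) := ⋃ s ∈ O, openConn s o with hU
  set T : Set (BondConfig (Fin n)) := ⋂ s ∈ O, openConn s b with hT
  set HH : Set (BondConfig (Fin n)) := ⋂ s ∈ O, {ω' : BondConfig (Fin n) | (openGraph (ω' \ {e | o ∈ e})).Reachable s b}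
    with hHH
  have hHT : HH ⊆ T := by
    intro ω hω
    simp only [hHH, hT, Set.mem_iInter, Set.mem_setOf_eq] at hω ⊢
    intro s hs
    exact knBr_reach_of_reachOff (hω s hs)
  -- on `T \ HH` the observer is joined to `O`
  have hbr : N ∩ (T \ HH) ⊆ N ∩ (U ∩ T) := by
    rintro ω ⟨hN, hTω, hHω⟩
    refine ⟨hN, ?_, hTω⟩
    simp only [hHH, Set.mem_iInter, Set.mem_setOf_eq, not_forall] at hHω
    obtain ⟨s, hs, hnot⟩ := hHω
    have hsb : (openGraph ω).Reachable s b := by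
      simp only [hT, Set.mem_iInter] at hTω
      exact hTω s hs
    simp only [hU, Set.mem_iUnion, exists_prop]
    exact ⟨s, hs, knBr_bridge hsb hnot⟩
  -- decomposition `N ∩ (U ∩ T) = (N ∩ (U ∩ HH)) ∪ (N ∩ (T \ HH))`, disjoint
  have hdec : N ∩ (U ∩ T) = (N ∩ (U ∩ HH)) ∪ (N ∩ (T \ HH)) := by
    ext ω
    constructor
    · rintro ⟨hN, hUω, hTω⟩
      by_cases hH : ω ∈ HH
      · exact Or.inl ⟨hN, hUω, hH⟩
      · exact Or.inr ⟨hN, hTω, hH⟩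
    · rintro (⟨hN, hUω, hH⟩ | h2)
      · exact ⟨hN, hUω, hHT hH⟩
      · exact hbr h2
  have hdisj : Disjoint (N ∩ (U ∩ HH)) (N ∩ (T \ HH)) := by
    rw [Set.disjoint_left]
    rintro ω ⟨-, -, hH⟩ ⟨-, -, hH'⟩
    exact hH' hH
  have h1 : (prodBernoulli w).real (N ∩ (U ∩ T)) =
      (prodBernoulli w).real (N ∩ (U ∩ HH)) + (prodBernoulli w).real (N ∩ (T \ HH)) := by
    rw [hdec, measureReal_union hdisj (hm _)]
  -- `μ(N ∩ (T \ HH)) = μ(N ∩ T) − μ(N ∩ HH)`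
  have h2 : (prodBernoulli w).real (N ∩ T) =
      (prodBernoulli w).real (N ∩ HH) + (prodBernoulli w).real (N ∩ (T \ HH)) := by
    have hdec2 : N ∩ T = (N ∩ HH) ∪ (N ∩ (T \ HH)) := by
      ext ω
      constructor
      · rintro ⟨hN, hTω⟩
        by_cases hH : ω ∈ HH
        · exact Or.inl ⟨hN, hH⟩
        · exact Or.inr ⟨hN, hTω, hH⟩
      · rintro (⟨hN, hH⟩ | ⟨hN, hTω, -⟩)
        · exact ⟨hN, hHT hH⟩
        · exact ⟨hN, hTω⟩
    have hdisj2 : Disjoint (N ∩ HH) (N ∩ (T \ HH)) := by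
      rw [Set.disjoint_left]
      rintro ω ⟨-, hH⟩ ⟨-, -, hH'⟩
      exact hH' hH
    rw [hdec2, measureReal_union hdisj2 (hm _)]
  linarith

/-- **Real-arithmetic core of the bridged exchange.**  From the three bridged plus-bounds `A_O h_O ≤ P_O V_O`,
`T_O = V_O + (m_O − h_O)`, the three minus-bounds `P_O U_O ≤ A_O m_{A∖O}`, `P_O > 0`, and the bridged certificate,
`(T₁₂ − U₁₂) + (T₁ − U₁) + (T₂ − U₂) ≥ 0`. [folklore] -/
theorem knBr_arith {T₁₂ V₁₂ U₁₂ T₁ V₁ U₁ T₂ V₂ U₂ P₁₂ P₁ P₂ A₁₂ A₁ A₂ m₁₂ h₁₂ m₃ m₁ h₁ m₂₃ m₂ h₂ m₁₃ : ℝ}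
    (hP₁₂ : 0 < P₁₂) (hP₁ : 0 < P₁) (hP₂ : 0 < P₂)
    (h1 : A₁₂ * h₁₂ ≤ P₁₂ * V₁₂) (e1 : T₁₂ = V₁₂ + (m₁₂ - h₁₂)) (h2 : P₁₂ * U₁₂ ≤ A₁₂ * m₃)
    (h3 : A₁ * h₁ ≤ P₁ * V₁) (e3 : T₁ = V₁ + (m₁ - h₁)) (h4 : P₁ * U₁ ≤ A₁ * m₂₃)
    (h5 : A₂ * h₂ ≤ P₂ * V₂) (e5 : T₂ = V₂ + (m₂ - h₂)) (h6 : P₂ * U₂ ≤ A₂ * m₁₃)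
    (hcert : 0 ≤ P₁ * P₂ * (A₁₂ * (h₁₂ - m₃) + P₁₂ * (m₁₂ - h₁₂))
        + P₂ * P₁₂ * (A₁ * (h₁ - m₂₃) + P₁ * (m₁ - h₁))
        + P₁ * P₁₂ * (A₂ * (h₂ - m₁₃) + P₂ * (m₂ - h₂))) :
    0 ≤ (T₁₂ - U₁₂) + (T₁ - U₁) + (T₂ - U₂) := by
  have ha : A₁₂ * (h₁₂ - m₃) + P₁₂ * (m₁₂ - h₁₂) ≤ P₁₂ * (T₁₂ - U₁₂) := by rw [e1]; nlinarith
  have hb : A₁ * (h₁ - m₂₃) + P₁ * (m₁ - h₁) ≤ P₁ * (T₁ - U₁) := by rw [e3]; nlinarith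
  have hc : A₂ * (h₂ - m₁₃) + P₂ * (m₂ - h₂) ≤ P₂ * (T₂ - U₂) := by rw [e5]; nlinarith
  have ha' : P₁ * P₂ * (A₁₂ * (h₁₂ - m₃) + P₁₂ * (m₁₂ - h₁₂)) ≤ P₁ * P₂ * (P₁₂ * (T₁₂ - U₁₂)) :=
    mul_le_mul_of_nonneg_left ha (mul_nonneg hP₁.le hP₂.le)
  have hb' : P₂ * P₁₂ * (A₁ * (h₁ - m₂₃) + P₁ * (m₁ - h₁)) ≤ P₂ * P₁₂ * (P₁ * (T₁ - U₁)) :=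
    mul_le_mul_of_nonneg_left hb (mul_nonneg hP₂.le hP₁₂.le)
  have hc' : P₁ * P₁₂ * (A₂ * (h₂ - m₁₃) + P₂ * (m₂ - h₂)) ≤ P₁ * P₁₂ * (P₂ * (T₂ - U₂)) :=
    mul_le_mul_of_nonneg_left hc (mul_nonneg hP₁.le hP₁₂.le)
  have hid : P₁ * P₂ * (P₁₂ * (T₁₂ - U₁₂)) + P₂ * P₁₂ * (P₁ * (T₁ - U₁)) + P₁ * P₁₂ * (P₂ * (T₂ - U₂)) =
      (P₁ * P₂ * P₁₂) * ((T₁₂ - U₁₂) + (T₁ - U₁) + (T₂ - U₂)) := by ring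
  have hprod : 0 < P₁ * P₂ * P₁₂ := mul_pos (mul_pos hP₁ hP₂) hP₁₂
  have hge : 0 ≤ (P₁ * P₂ * P₁₂) * ((T₁₂ - U₁₂) + (T₁ - U₁) + (T₂ - U₂)) := by linarith
  by_contra hneg
  push Not at hneg
  have := mul_neg_of_pos_of_neg hprod hneg
  linarith

end

end Summit.CriticalPhenomena.PercolationContinuityZ3.Theorems
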